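/-
Copyright (c) 2026. All rights reserved.
Released under Apache 2.0 license as described in the file LICENSE.
-/
import Literature.NumberTheory.ComplexMultiplication.CMTypeElementaryTwoGroupOddWeights
import Literature.NumberTheory.ComplexMultiplication.DegenerateCMTypesAbelianKernels
import HarnessLib

/-!
# CM types on an ELEMENTARY ABELIAN `2`-GROUP: the sign counts, their common parity, Parseval over the odd
# characters — odd types are nondegenerate, even types on groups of order `8` and `16` have rank `2`, resp. `2` or `5`,
# and rank `2` means induced from an index-`2` subgroup

T. Kubota, *On the field extension by complex multiplication*, Trans. AMS 118 (1965) [Kubota1965], §4 LEMMA 2 (the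
tree's `IsCMTypeWith.typeRank_eq_one_add_ncard_oddCharacters`, B. B. Gordon [Gordon1999HodgeAVSurvey] Prop. 9.4.1):
for a CM type `T` of a finite commutative group `G` with complex conjugation `ρ`,
`rank(T) = 1 + #{χ : χ(ρ) = −1, Σ_{s∈T} χ(s) ≠ 0}`.  Here `G` has EXPONENT `2` (`g² = 1`; the Galois group of a
multiquadratic CM field `ℚ(√−d, √a₁, …, √a_r)`), so that every character is `±1`-valued (tree
`character_apply_eq_one_or_of_mul_self`) and every character sum over `T` is the INTEGER
`Σ_{s∈T} χ(s) = |T| − 2·a_χ(T)`, `a_χ(T) = #{s ∈ T : χ(s) = −1}` (§1).  For an odd `χ` with kernel `H`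
(`[G:H] = 2`, `ρ ∉ H`), `a_χ(T) = #(T ∖ H)`: on the CM field, the number of elements of the CM type extending the
conjugate of the base embedding of the imaginary quadratic subfield `K^H` (B. Dodson [Dodson1984] §3.1.1: the weight
of `f` over the imaginary quadratic subfield; the type is of Weil type over `K^H` iff `a_χ(T) = |T|/2`, the tree's
`CyclicCMType.AbelianKernels.sum_char_eq_zero_iff_of_index_two`).  We prove, for `T` a CM type (`T ⊔ ρT = G`):

* §2 `two_mul_card_filter_univ_eq` (a character `ψ ≠ 1` equals `−1` on exactly `|G|/2` elements),
  `four_mul_card_filter_eq` (an EVEN character `ψ ≠ 1`, `ψ(ρ) = 1`, equals `−1` on exactly `|G|/4` elements of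
  `T`), `sum_char_eq_zero_of_even` (even `ψ ≠ 1` vanishes on `T`), and **THE COMMON PARITY**
  `two_mul_card_filter_add_eq` / **`card_filter_mod_two_eq`**: for odd `χ ≠ χ'`,
  `2(a_χ + a_{χ'}) = |T| + 4·#{s ∈ T : χ(s) = χ'(s) = −1}`, so that for `8 ∣ |G|` ALL the sign counts `a_χ(T)`,
  `χ` odd, HAVE THE SAME PARITY — the parity `ε(T)` of the type (for `|G| = 4` the two counts have opposite
  parity: the biquadratic case).
* §3 **PARSEVAL**: `sum_sq_sum_char_eq` (`Σ_χ (Σ_{s∈S} χ(s))² = |S|·|G|` for every `S ⊆ G`) and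
  **`sum_odd_sq_sum_char_eq`** (`Σ_{χ odd} (Σ_{s∈T} χ(s))² = |T|²` for a CM type: the even non-trivial characters
  vanish on `T`, the trivial one gives `|T|²`); integer form `sum_odd_sq_eq_int`.
* §4 **ODD TYPES ARE NONDEGENERATE** (`8 ∣ |G|`): `sum_char_ne_zero_of_odd`, **`typeRank_eq_of_odd`** — if one
  (equivalently every) sign count `a_χ(T)` is odd then no odd character vanishes on `T` (`|T| − 2a_χ ≡ 2 (mod 4)`)
  and `rank(T) = |G|/2 + 1`.
* §5 **EVEN TYPES** (`8 ∣ |G|`, some `a_χ(T)` even): every `Σ_T χ ≡ 0 (mod 4)`, so Parseval bounds the number of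
  non-vanishing odd characters: **`sixteen_mul_typeRank_sub_one_le`** (`16(rank(T) − 1) ≤ |T|²`); for `|G| = 8`
  **`typeRank_eq_two_of_even`** (`rank = 2`: exactly one odd character survives, with `(Σ_T χ)² = 16`), for
  `|G| = 16` **`typeRank_eq_two_or_five_of_even`** (`rank ∈ {2, 5}`: `64 = 64·n₆₄ + 16·n₁₆`); hence
  `typeRank_eq_five_or_two_of_card_eight` (on `(ℤ/2)³` every CM type has rank `5` or `2`) and
  `typeRank_mem_of_card_sixteen` (on `(ℤ/2)⁴`: rank `9`, `5` or `2`).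
* §6 **RANK `2` ⟺ INDUCED FROM AN INDEX-`2` SUBGROUP** (any exponent-`2` group): `typeRank_eq_two_iff` (`rank(T) = 2`
  iff some odd character is CONSTANT on `T`) and **`typeRank_eq_two_iff_exists_subgroup`** (`rank(T) = 2` iff
  `T = H` or `T = G ∖ H = ρH` for a subgroup `H ∌ ρ` of index `2` — on the CM field: the type is the full set of
  extensions of a CM type of an imaginary quadratic subfield).

HONEST SCOPE.  These are consequences of Kubota's Lemma 2 and character orthogonality specialised to exponent `2`
(where character sums are integers and Parseval becomes a sum of integer squares); the parity invariant and the rank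
spectra `{5, 2}` (order `8`) and `{9, 5, 2}` (order `16`) are this regrouping, not formulas printed in the sources
(Dodson's §3.3.2 Theorem — a simple CM fourfold whose Galois group is abelian is nondegenerate — is the order-`8`
statement read on fields; the tree's `AbelianTwoPower.typeRank_add_ncard_equidistributed` is the character count for
all `2`-groups).  THEOREMS ONLY: no definition, no named fact, no instance, no `sorry`.

## References

* [Kubota1965] T. Kubota, Trans. AMS 118 (1965), §4 Lemma 2 (held text, p. 119).
* [Dodson1984] B. Dodson, *The structure of Galois groups of CM-fields*, Trans. AMS 283 (1984), §3.1.1 Theorem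
  (constant weight criterion), §3.3.2 Theorem (degenerate simple CM fourfolds) (held text, pp. 11–12, 16).
* [Gordon1999HodgeAVSurvey] B. B. Gordon, *A survey of the Hodge conjecture for abelian varieties*, 9.4.1, 5.13.
* [MoonenZarhin1999LowDim] B. Moonen, Yu. Zarhin, Math. Ann. 315 (1999), Thm. (0.2) (CM fourfolds).
* [Shimura1998] G. Shimura, *Abelian Varieties with Complex Multiplication and Modular Functions*, §8.4 Example (2)(A).

## Provenance

Lane `lit-hodgefound` (Track 2, Layer A3), seat `lit-hodgefound-p10` generation 37, row g37-#3 (group level of the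
multiquadratic programme g37-#2 `Pohlmann1968/DegenerateCMTypesMultiquadraticCMField`); neighbours cited by name,
nothing restated: `CMTypeElementaryTwoGroupOddWeights` (`character_apply_eq_one_or_of_mul_self`,
`sum_character_eq_zero_of_ne_zero`), `Pohlmann1968/CMTypeRankCharactersNumberField`
(`IsCMTypeWith.typeRank_eq_iff_forall_oddCharacters`), `CMTypeRankCharacters`
(`IsCMTypeWith.typeRank_eq_one_add_ncard_oddCharacters`), `DegenerateCMTypesAbelianKernels`
(`CyclicCMType.AbelianKernels.exists_oddChar_ker`), Mathlib `AddChar.sum_apply_eq_ite` (orthogonality).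
-/

open scoped BigOperators Classical

namespace Literature.NumberTheory.ComplexMultiplication

namespace CyclicCMType

namespace ExponentTwo

variable {G : Type*} [CommGroup G] [Fintype G] [DecidableEq G] {ρ : G} {T : Finset G}

/-! ## §0 Helpers: exponent `2`, characters, CM types -/

section Helpers

omit [Fintype G] [DecidableEq G] in
/-- `g·g = 1` in exponent `2`. [folklore] -/
private theorem mul_self_eq_one (hexp : ∀ g : G, g ^ 2 = 1) (g : G) : g * g = 1 := by
  rw [← pow_two]; exact hexp g

omit [Fintype G] [DecidableEq G] in
/-- `g⁻¹ = g` in exponent `2`. [folklore] -/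
private theorem inv_eq_self (hexp : ∀ g : G, g ^ 2 = 1) (g : G) : g⁻¹ = g :=
  inv_eq_of_mul_eq_one_right (mul_self_eq_one hexp g)

omit [Fintype G] [DecidableEq G] in
/-- Characters of a group of exponent `2` are `±1`-valued. [cite: Kubota1965, §4 Lemma 2 (proof)] -/
private theorem char_eq_one_or (hexp : ∀ g : G, g ^ 2 = 1) (χ : AddChar (Additive G) ℂ) (g : G) :
    χ (Additive.ofMul g) = 1 ∨ χ (Additive.ofMul g) = -1 :=
  character_apply_eq_one_or_of_mul_self χ (mul_self_eq_one hexp g)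

omit [Fintype G] [DecidableEq G] in
/-- `χ(gh) = χ(g)χ(h)`. [folklore] -/
private theorem char_mul (χ : AddChar (Additive G) ℂ) (g h : G) :
    χ (Additive.ofMul (g * h)) = χ (Additive.ofMul g) * χ (Additive.ofMul h) := by
  rw [ofMul_mul, AddChar.map_add_eq_mul]

/-- Dual orthogonality: `Σ_χ χ(x) = |G|·[x = 1]` (Mathlib `AddChar.sum_apply_eq_ite`). [folklore] -/
private theorem sum_char_apply_eq_ite (x : G) :
    ∑ χ : AddChar (Additive G) ℂ, χ (Additive.ofMul x) = if x = 1 then (Fintype.card G : ℂ) else 0 := by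
  have h := AddChar.sum_apply_eq_ite (α := Additive G) (Additive.ofMul x)
  have hc : Fintype.card (Additive G) = Fintype.card G := Fintype.card_congr Additive.toMul
  rw [h, hc]
  by_cases hx : x = 1
  · subst hx; simp
  · rw [if_neg hx, if_neg]
    exact fun h' => hx (Additive.ofMul.injective (by rw [h']; rfl))

omit [Fintype G] [DecidableEq G] in
/-- `ρ² = 1` for the conjugation of a CM type. [folklore] -/
private theorem rho_mul_rho (h : IsCMTypeWith ρ (T : Set G)) : ρ * ρ = 1 := by
  have := h.invol (1 : G)
  simpa [smul_eq_mul] using this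

omit [Fintype G] [DecidableEq G] in
/-- `ρx ∈ T ↔ x ∉ T`. [folklore] -/
private theorem rho_mul_mem_iff (h : IsCMTypeWith ρ (T : Set G)) (x : G) : ρ * x ∈ T ↔ x ∉ T := by
  have := h.rho_smul_mem_iff x
  simpa only [smul_eq_mul, Finset.mem_coe] using this

/-- `G ∖ T = ρT`. [folklore] -/
private theorem compl_eq_image (h : IsCMTypeWith ρ (T : Set G)) : Tᶜ = T.image fun s => ρ * s := by
  ext x
  rw [Finset.mem_compl, Finset.mem_image]
  constructor
  · intro hx
    refine ⟨ρ * x, (rho_mul_mem_iff h x).2 hx, ?_⟩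
    rw [← mul_assoc, rho_mul_rho h, one_mul]
  · rintro ⟨s, hs, rfl⟩
    exact fun hx => ((rho_mul_mem_iff h s).1 hx) hs

/-- `|G| = 2|T|`. [folklore] -/
private theorem two_mul_card (h : IsCMTypeWith ρ (T : Set G)) : 2 * T.card = Fintype.card G := by
  have hinj : Function.Injective fun s : G => ρ * s := fun a b hab => mul_left_cancel hab
  have h1 : Tᶜ.card = T.card := by rw [compl_eq_image h, Finset.card_image_of_injective _ hinj]
  have h2 := Finset.card_add_card_compl T
  omega

end Helpers

/-! ## §1 The sign count `a_χ(S) = #{s ∈ S : χ(s) = −1}` -/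

section SignCount

omit [Fintype G] [DecidableEq G] in
/-- **The character sum is an integer**: in exponent `2`, `Σ_{s∈S} χ(s) = |S| − 2·#{s ∈ S : χ(s) = −1}`.
[cite: Kubota1965, §4 Lemma 2] [cite: Dodson1984, §3.1.1 Theorem] -/
theorem sum_char_eq_card_sub_two_mul (hexp : ∀ g : G, g ^ 2 = 1) (χ : AddChar (Additive G) ℂ) (S : Finset G) :
    ∑ s ∈ S, χ (Additive.ofMul s) =
      (S.card : ℂ) - 2 * ((S.filter fun s => χ (Additive.ofMul s) = -1).card : ℂ) := by
  have hval : ∀ s ∈ S.filter (fun s => ¬ χ (Additive.ofMul s) = -1), χ (Additive.ofMul s) = 1 := fun s hs =>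
    (char_eq_one_or hexp χ s).resolve_right (Finset.mem_filter.1 hs).2
  have hneg : ∀ s ∈ S.filter (fun s => χ (Additive.ofMul s) = -1), χ (Additive.ofMul s) = -1 := fun s hs =>
    (Finset.mem_filter.1 hs).2
  have hcard := Finset.card_filter_add_card_filter_not (s := S) (fun s => χ (Additive.ofMul s) = -1)
  rw [← Finset.sum_filter_add_sum_filter_not S (fun s => χ (Additive.ofMul s) = -1),
    Finset.sum_congr rfl hneg, Finset.sum_congr rfl hval, Finset.sum_const, Finset.sum_const, nsmul_eq_mul,
    nsmul_eq_mul, mul_one, mul_neg, mul_one]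
  have hc : ((S.filter fun s => ¬ χ (Additive.ofMul s) = -1).card : ℂ) =
      S.card - (S.filter fun s => χ (Additive.ofMul s) = -1).card := by
    rw [eq_sub_iff_add_eq, ← Nat.cast_add, add_comm, hcard]
  rw [hc]
  ring

omit [Fintype G] [DecidableEq G] in
/-- Integer form: `Σ_{s∈S} χ(s) = ((|S| : ℤ) − 2·#{s ∈ S : χ(s) = −1} : ℂ)`. [cite: Kubota1965, §4 Lemma 2] -/
theorem sum_char_eq_intCast (hexp : ∀ g : G, g ^ 2 = 1) (χ : AddChar (Additive G) ℂ) (S : Finset G) :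
    ∑ s ∈ S, χ (Additive.ofMul s) =
      (((S.card : ℤ) - 2 * ((S.filter fun s => χ (Additive.ofMul s) = -1).card : ℤ) : ℤ) : ℂ) := by
  rw [sum_char_eq_card_sub_two_mul hexp χ S]
  push_cast
  ring

omit [Fintype G] [DecidableEq G] in
/-- A character sum over `S` vanishes iff `χ = −1` on exactly half of `S`: `2·#{s ∈ S : χ(s) = −1} = |S|`.
[cite: Kubota1965, §4 Lemma 2] [cite: Dodson1984, §3.1.1 Theorem] -/
theorem sum_char_eq_zero_iff_two_mul_card_filter_eq (hexp : ∀ g : G, g ^ 2 = 1) (χ : AddChar (Additive G) ℂ)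
    (S : Finset G) :
    ∑ s ∈ S, χ (Additive.ofMul s) = 0 ↔ 2 * (S.filter fun s => χ (Additive.ofMul s) = -1).card = S.card := by
  rw [sum_char_eq_card_sub_two_mul hexp χ S, sub_eq_zero]
  constructor
  · intro h; exact_mod_cast h.symm
  · intro h; exact_mod_cast h.symm

end SignCount

/-! ## §2 Even characters on a CM type; the common parity of the sign counts -/

section Parity

omit [DecidableEq G] in
/-- **A non-trivial character of a group of exponent `2` equals `−1` on exactly half of the group**:
`2·#{g : ψ(g) = −1} = |G|` (from `Σ_G ψ = 0`). [cite: Kubota1965, §4 Lemma 2] -/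
theorem two_mul_card_filter_univ_eq (hexp : ∀ g : G, g ^ 2 = 1) {ψ : AddChar (Additive G) ℂ} (hψ : ψ ≠ 0) :
    2 * (Finset.univ.filter fun g : G => ψ (Additive.ofMul g) = -1).card = Fintype.card G := by
  have h1 := sum_char_eq_card_sub_two_mul hexp ψ Finset.univ
  rw [Finset.card_univ, sum_character_eq_zero_of_ne_zero hψ] at h1
  have h2 : (2 * ((Finset.univ.filter fun g : G => ψ (Additive.ofMul g) = -1).card : ℂ)) = Fintype.card G := by
    linear_combination h1
  exact_mod_cast h2

/-- **An even character `ψ ≠ 1` equals `−1` on exactly a quarter of `G` inside a CM type**: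
`4·#{s ∈ T : ψ(s) = −1} = |G|` (the set `{ψ = −1}` is `ρ`-stable and `G = T ⊔ ρT`). [cite: Kubota1965, §4 Lemma 2] -/
theorem four_mul_card_filter_eq (hexp : ∀ g : G, g ^ 2 = 1) (h : IsCMTypeWith ρ (T : Set G))
    {ψ : AddChar (Additive G) ℂ} (hψρ : ψ (Additive.ofMul ρ) = 1) (hψ : ψ ≠ 0) :
    4 * (T.filter fun s => ψ (Additive.ofMul s) = -1).card = Fintype.card G := by
  have hinj : Function.Injective fun s : G => ρ * s := fun a b hab => mul_left_cancel hab
  have himg : (Tᶜ.filter fun s => ψ (Additive.ofMul s) = -1) =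
      (T.filter fun s => ψ (Additive.ofMul s) = -1).image (fun s => ρ * s) := by
    ext x
    simp only [Finset.mem_filter, Finset.mem_compl, Finset.mem_image]
    constructor
    · rintro ⟨hx, hψx⟩
      refine ⟨ρ * x, ⟨(rho_mul_mem_iff h x).2 hx, by rw [char_mul, hψρ, one_mul]; exact hψx⟩, ?_⟩
      rw [← mul_assoc, rho_mul_rho h, one_mul]
    · rintro ⟨s, ⟨hs, hψs⟩, rfl⟩
      exact ⟨fun hx => (rho_mul_mem_iff h s).1 hx hs, by rw [char_mul, hψρ, one_mul]; exact hψs⟩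
  have hT : (Tᶜ.filter fun s => ψ (Additive.ofMul s) = -1).card =
      (T.filter fun s => ψ (Additive.ofMul s) = -1).card := by
    rw [himg, Finset.card_image_of_injective _ hinj]
  have hsplit : (T.filter fun s => ψ (Additive.ofMul s) = -1).card +
      (Tᶜ.filter fun s => ψ (Additive.ofMul s) = -1).card =
      (Finset.univ.filter fun g : G => ψ (Additive.ofMul g) = -1).card := by
    rw [← Finset.card_union_of_disjoint (Finset.disjoint_filter_filter disjoint_compl_right),
      ← Finset.filter_union, Finset.union_compl]
  have h2 := two_mul_card_filter_univ_eq hexp hψ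
  omega

/-- **An even non-trivial character vanishes on every CM type**: `Σ_{s∈T} ψ(s) = 0` for `ψ(ρ) = 1`, `ψ ≠ 1`
(`Σ_G ψ = Σ_T ψ + Σ_{ρT} ψ = 2 Σ_T ψ`). [cite: Kubota1965, §4 Lemma 2 (proof)] -/
theorem sum_char_eq_zero_of_even (h : IsCMTypeWith ρ (T : Set G)) {ψ : AddChar (Additive G) ℂ}
    (hψρ : ψ (Additive.ofMul ρ) = 1) (hψ : ψ ≠ 0) : ∑ s ∈ T, ψ (Additive.ofMul s) = 0 := by
  have hinj : Function.Injective fun s : G => ρ * s := fun a b hab => mul_left_cancel hab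
  have htot : ∑ g : G, ψ (Additive.ofMul g) = 0 := sum_character_eq_zero_of_ne_zero hψ
  have hc : ∑ s ∈ Tᶜ, ψ (Additive.ofMul s) = ∑ s ∈ T, ψ (Additive.ofMul s) := by
    rw [compl_eq_image h, Finset.sum_image fun a _ b _ hab => hinj hab]
    exact Finset.sum_congr rfl fun s _ => by rw [char_mul, hψρ, one_mul]
  rw [← Finset.sum_add_sum_compl T, hc] at htot
  linear_combination htot / 2

omit [Fintype G] [DecidableEq G] in
/-- In exponent `2` the character group has exponent `2`: `−χ = χ`. [folklore] -/
private theorem neg_char_eq (hexp : ∀ g : G, g ^ 2 = 1) (χ : AddChar (Additive G) ℂ) : -χ = χ := by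
  ext a
  rw [AddChar.neg_apply]
  have : -a = a := by
    have h1 : Additive.toMul (-a) = Additive.toMul a := by rw [toMul_neg, inv_eq_self hexp]
    exact Additive.toMul.injective h1
  rw [this]

/-- **The sign counts of two odd characters**: for `χ ≠ χ'` odd (`χ(ρ) = χ'(ρ) = −1`) and a CM type `T`,
`2·(a_χ(T) + a_{χ'}(T)) = |T| + 4·#{s ∈ T : χ(s) = χ'(s) = −1}` — from `Σ_T (1 − χ)(1 − χ') = 4·#{both}` and the
vanishing of the even character `χχ'` on `T`. [cite: Kubota1965, §4 Lemma 2] [cite: Dodson1984, §3.1.1 Theorem] -/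
theorem two_mul_card_filter_add_eq (hexp : ∀ g : G, g ^ 2 = 1) (h : IsCMTypeWith ρ (T : Set G))
    {χ χ' : AddChar (Additive G) ℂ} (hχ : χ (Additive.ofMul ρ) = -1) (hχ' : χ' (Additive.ofMul ρ) = -1)
    (hne : χ ≠ χ') :
    2 * ((T.filter fun s => χ (Additive.ofMul s) = -1).card + (T.filter fun s => χ' (Additive.ofMul s) = -1).card) =
      T.card + 4 * (T.filter fun s => χ (Additive.ofMul s) = -1 ∧ χ' (Additive.ofMul s) = -1).card := by
  -- the even character `ψ = χχ'` is non-trivial and vanishes on `T`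
  have hψρ : (χ + χ') (Additive.ofMul ρ) = 1 := by rw [AddChar.add_apply, hχ, hχ']; norm_num
  have hψ : χ + χ' ≠ 0 := fun h0 => hne (by
    have : χ' = -χ := (neg_eq_of_add_eq_zero_right h0).symm
    rw [this, neg_char_eq hexp])
  have hψ0 := sum_char_eq_zero_of_even h hψρ hψ
  -- pointwise: `(1 − χ s)(1 − χ' s) = 4·[χ s = χ' s = −1]`
  have hpt : ∀ s : G, (1 - χ (Additive.ofMul s)) * (1 - χ' (Additive.ofMul s)) =
      4 * (if χ (Additive.ofMul s) = -1 ∧ χ' (Additive.ofMul s) = -1 then (1 : ℂ) else 0) := by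
    intro s
    rcases char_eq_one_or hexp χ s with h1 | h1 <;> rcases char_eq_one_or hexp χ' s with h2 | h2 <;>
      simp [h1, h2] <;> norm_num
  have hsum : ∑ s ∈ T, (1 - χ (Additive.ofMul s)) * (1 - χ' (Additive.ofMul s)) =
      4 * ((T.filter fun s => χ (Additive.ofMul s) = -1 ∧ χ' (Additive.ofMul s) = -1).card : ℂ) := by
    rw [Finset.sum_congr rfl fun s _ => hpt s, ← Finset.mul_sum, Finset.sum_boole]
  have hexpand : ∑ s ∈ T, (1 - χ (Additive.ofMul s)) * (1 - χ' (Additive.ofMul s)) =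
      (T.card : ℂ) - ∑ s ∈ T, χ (Additive.ofMul s) - ∑ s ∈ T, χ' (Additive.ofMul s) +
        ∑ s ∈ T, (χ + χ') (Additive.ofMul s) := by
    have : ∀ s : G, (1 - χ (Additive.ofMul s)) * (1 - χ' (Additive.ofMul s)) =
        1 - χ (Additive.ofMul s) - χ' (Additive.ofMul s) + (χ + χ') (Additive.ofMul s) := fun s => by
      rw [AddChar.add_apply]; ring
    rw [Finset.sum_congr rfl fun s _ => this s, Finset.sum_add_distrib, Finset.sum_sub_distrib,
      Finset.sum_sub_distrib, Finset.sum_const, nsmul_eq_mul, mul_one]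
  rw [hexpand, hψ0, add_zero, sum_char_eq_card_sub_two_mul hexp χ T, sum_char_eq_card_sub_two_mul hexp χ' T] at hsum
  have key : (2 * (((T.filter fun s => χ (Additive.ofMul s) = -1).card : ℂ) +
      ((T.filter fun s => χ' (Additive.ofMul s) = -1).card : ℂ))) =
      (T.card : ℂ) + 4 * ((T.filter fun s => χ (Additive.ofMul s) = -1 ∧ χ' (Additive.ofMul s) = -1).card : ℂ) := by
    linear_combination hsum
  exact_mod_cast key

/-- **THE COMMON PARITY OF THE SIGN COUNTS.**  On a group of exponent `2` and order divisible by `8`, for a CM type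
`T` all the counts `a_χ(T) = #{s ∈ T : χ(s) = −1}`, `χ` odd, have the same parity (for `|G| = 4` the two counts
have opposite parities). [cite: Kubota1965, §4 Lemma 2] [cite: Dodson1984, §3.1.1 Theorem] -/
theorem card_filter_mod_two_eq (hexp : ∀ g : G, g ^ 2 = 1) (h : IsCMTypeWith ρ (T : Set G))
    (h8 : 8 ∣ Fintype.card G) {χ χ' : AddChar (Additive G) ℂ} (hχ : χ (Additive.ofMul ρ) = -1)
    (hχ' : χ' (Additive.ofMul ρ) = -1) :
    (T.filter fun s => χ (Additive.ofMul s) = -1).card % 2 =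
      (T.filter fun s => χ' (Additive.ofMul s) = -1).card % 2 := by
  by_cases hne : χ = χ'
  · subst hne; rfl
  have key := two_mul_card_filter_add_eq hexp h hχ hχ' hne
  have hT := two_mul_card h
  obtain ⟨c, hc⟩ := h8
  omega

end Parity

/-! ## §3 Parseval over the odd characters -/

section Parseval

omit [DecidableEq G] in
/-- **Parseval in exponent `2`**: `Σ_χ (Σ_{s∈S} χ(s))² = |S|·|G|` for every `S ⊆ G` (orthogonality
`Σ_χ χ(st) = |G|·[st = 1]`, and `st = 1 ⟺ s = t`). [cite: Kubota1965, §4 Lemma 2 (proof)] -/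
theorem sum_sq_sum_char_eq (hexp : ∀ g : G, g ^ 2 = 1) (S : Finset G) :
    ∑ χ : AddChar (Additive G) ℂ, (∑ s ∈ S, χ (Additive.ofMul s)) ^ 2 = (S.card : ℂ) * Fintype.card G := by
  calc ∑ χ : AddChar (Additive G) ℂ, (∑ s ∈ S, χ (Additive.ofMul s)) ^ 2
      = ∑ χ : AddChar (Additive G) ℂ, ∑ s ∈ S, ∑ t ∈ S, χ (Additive.ofMul (s * t)) := by
        refine Finset.sum_congr rfl fun χ _ => ?_
        rw [sq, Finset.sum_mul_sum]
        exact Finset.sum_congr rfl fun s _ => Finset.sum_congr rfl fun t _ => by rw [char_mul]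
    _ = ∑ s ∈ S, ∑ t ∈ S, ∑ χ : AddChar (Additive G) ℂ, χ (Additive.ofMul (s * t)) := by
        rw [Finset.sum_comm]
        exact Finset.sum_congr rfl fun s _ => Finset.sum_comm
    _ = ∑ s ∈ S, ∑ t ∈ S, (if s = t then (Fintype.card G : ℂ) else 0) := by
        refine Finset.sum_congr rfl fun s _ => Finset.sum_congr rfl fun t _ => ?_
        rw [sum_char_apply_eq_ite]
        by_cases hst : s = t
        · rw [if_pos hst, if_pos (by rw [hst]; exact mul_self_eq_one hexp t)]
        · rw [if_neg hst, if_neg fun h1 => hst (by rwa [mul_eq_one_iff_eq_inv, inv_eq_self hexp] at h1)]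
    _ = ∑ s ∈ S, (Fintype.card G : ℂ) := Finset.sum_congr rfl fun s hs => Finset.sum_ite_eq_of_mem _ _ _ hs
    _ = (S.card : ℂ) * Fintype.card G := by rw [Finset.sum_const, nsmul_eq_mul]

/-- **PARSEVAL OVER THE ODD CHARACTERS**: for a CM type `T` on a group of exponent `2`,
`Σ_{χ(ρ) = −1} (Σ_{s∈T} χ(s))² = |T|²` — the even non-trivial characters vanish on `T`
(`sum_char_eq_zero_of_even`) and the trivial one contributes `|T|²` to `Σ_χ (Σ_T χ)² = |T|·|G| = 2|T|²`.
[cite: Kubota1965, §4 Lemma 2] -/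
theorem sum_odd_sq_sum_char_eq (hexp : ∀ g : G, g ^ 2 = 1) (h : IsCMTypeWith ρ (T : Set G)) :
    ∑ χ ∈ Finset.univ.filter (fun χ : AddChar (Additive G) ℂ => χ (Additive.ofMul ρ) = -1),
      (∑ s ∈ T, χ (Additive.ofMul s)) ^ 2 = (T.card : ℂ) ^ 2 := by
  have htot := sum_sq_sum_char_eq hexp T
  rw [← Finset.sum_filter_add_sum_filter_not Finset.univ
    (fun χ : AddChar (Additive G) ℂ => χ (Additive.ofMul ρ) = -1)] at htot
  have hmem : (0 : AddChar (Additive G) ℂ) ∈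
      Finset.univ.filter (fun χ : AddChar (Additive G) ℂ => ¬ χ (Additive.ofMul ρ) = -1) := by
    rw [Finset.mem_filter, AddChar.zero_apply]
    exact ⟨Finset.mem_univ _, by norm_num⟩
  have heven : ∑ χ ∈ Finset.univ.filter (fun χ : AddChar (Additive G) ℂ => ¬ χ (Additive.ofMul ρ) = -1),
      (∑ s ∈ T, χ (Additive.ofMul s)) ^ 2 = (T.card : ℂ) ^ 2 := by
    calc _ = ∑ χ ∈ Finset.univ.filter (fun χ : AddChar (Additive G) ℂ => ¬ χ (Additive.ofMul ρ) = -1),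
          (if χ = 0 then (T.card : ℂ) ^ 2 else 0) := Finset.sum_congr rfl fun χ hχ => by
            have hχρ : χ (Additive.ofMul ρ) = 1 :=
              (char_eq_one_or hexp χ ρ).resolve_right (Finset.mem_filter.1 hχ).2
            by_cases h0 : χ = 0
            · rw [if_pos h0, h0]
              simp only [AddChar.zero_apply, Finset.sum_const, nsmul_eq_mul, mul_one]
            · rw [if_neg h0, sum_char_eq_zero_of_even h hχρ h0]
              norm_num
      _ = (T.card : ℂ) ^ 2 := by rw [Finset.sum_ite_eq', if_pos hmem]
  have h2 : (Fintype.card G : ℂ) = 2 * T.card := by exact_mod_cast (two_mul_card h).symm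
  rw [heven, h2] at htot
  linear_combination htot

/-- Integer form of Parseval over the odd characters: `Σ_{χ odd} (|T| − 2a_χ(T))² = |T|²` in `ℤ`.
[cite: Kubota1965, §4 Lemma 2] -/
theorem sum_odd_sq_eq_int (hexp : ∀ g : G, g ^ 2 = 1) (h : IsCMTypeWith ρ (T : Set G)) :
    ∑ χ ∈ Finset.univ.filter (fun χ : AddChar (Additive G) ℂ => χ (Additive.ofMul ρ) = -1),
      ((T.card : ℤ) - 2 * ((T.filter fun s => χ (Additive.ofMul s) = -1).card : ℤ)) ^ 2 = (T.card : ℤ) ^ 2 := by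
  have hC := sum_odd_sq_sum_char_eq hexp h
  rw [Finset.sum_congr rfl fun χ _ => by rw [sum_char_eq_intCast hexp χ T]] at hC
  exact_mod_cast hC

/-- **`rank(T) ≥ 2`**: some odd character does not vanish on `T` (Parseval: the odd squares sum to `|T|² > 0`).
[cite: Kubota1965, §4 Lemma 2] -/
theorem exists_odd_sum_char_ne_zero (hexp : ∀ g : G, g ^ 2 = 1) (h : IsCMTypeWith ρ (T : Set G)) :
    ∃ χ : AddChar (Additive G) ℂ, χ (Additive.ofMul ρ) = -1 ∧ ∑ s ∈ T, χ (Additive.ofMul s) ≠ 0 := by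
  by_contra hno
  have hno' : ∀ χ : AddChar (Additive G) ℂ, χ (Additive.ofMul ρ) = -1 → ∑ s ∈ T, χ (Additive.ofMul s) = 0 :=
    fun χ hχ => by_contra fun hne => hno ⟨χ, hχ, hne⟩
  have hP := sum_odd_sq_sum_char_eq hexp h
  rw [Finset.sum_eq_zero fun χ hχ => by rw [hno' χ (Finset.mem_filter.1 hχ).2]; norm_num] at hP
  have hT : 0 < T.card := by
    have := two_mul_card h
    have : 0 < Fintype.card G := Fintype.card_pos
    omega
  have : (T.card : ℂ) ^ 2 ≠ 0 := pow_ne_zero _ (by exact_mod_cast hT.ne')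
  exact this hP.symm

end Parseval

/-! ## §4 Odd types are nondegenerate -/

section Odd

/-- **ODD SIGN COUNT ⟹ NO ODD CHARACTER VANISHES** (`8 ∣ |G|`): if `a_{χ₀}(T)` is odd for one odd `χ₀`, then
`Σ_T χ = |T| − 2a_χ(T) ≠ 0` for EVERY odd `χ` (all `a_χ(T)` are odd, `|T| ≡ 0 (mod 4)`).
[cite: Kubota1965, §4 Lemma 2] [cite: Dodson1984, §3.1.1 Theorem] -/
theorem sum_char_ne_zero_of_odd (hexp : ∀ g : G, g ^ 2 = 1) (h : IsCMTypeWith ρ (T : Set G))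
    (h8 : 8 ∣ Fintype.card G) {χ₀ : AddChar (Additive G) ℂ} (hχ₀ : χ₀ (Additive.ofMul ρ) = -1)
    (hodd : Odd (T.filter fun s => χ₀ (Additive.ofMul s) = -1).card)
    {χ : AddChar (Additive G) ℂ} (hχ : χ (Additive.ofMul ρ) = -1) :
    ∑ s ∈ T, χ (Additive.ofMul s) ≠ 0 := by
  intro h0
  have h2 := (sum_char_eq_zero_iff_two_mul_card_filter_eq hexp χ T).1 h0
  have hpar := card_filter_mod_two_eq hexp h h8 hχ₀ hχ
  have hT := two_mul_card h
  obtain ⟨c, hc⟩ := h8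
  obtain ⟨k, hk⟩ := hodd
  omega

/-- **ODD TYPES ARE NONDEGENERATE**: on a group of exponent `2` with `8 ∣ |G|`, a CM type one of whose sign counts
`a_χ(T)` (`χ` odd) is odd has `rank(T) = |G|/2 + 1`. [cite: Kubota1965, §4 Lemma 2] [cite: Dodson1984, §3.1.1 Theorem] -/
theorem typeRank_eq_of_odd (hexp : ∀ g : G, g ^ 2 = 1) (h : IsCMTypeWith ρ (T : Set G))
    (h8 : 8 ∣ Fintype.card G) {χ₀ : AddChar (Additive G) ℂ} (hχ₀ : χ₀ (Additive.ofMul ρ) = -1)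
    (hodd : Odd (T.filter fun s => χ₀ (Additive.ofMul s) = -1).card) :
    typeRank G (T : Set G) = Fintype.card G / 2 + 1 :=
  h.typeRank_eq_iff_forall_oddCharacters.2 fun _ hχ => sum_char_ne_zero_of_odd hexp h h8 hχ₀ hodd hχ

/-- **A degenerate type is even** (contrapositive, `8 ∣ |G|`): if `rank(T) < |G|/2 + 1` then every sign count
`a_χ(T)`, `χ` odd, is even. [cite: Kubota1965, §4 Lemma 2] [cite: Dodson1984, §3.1.1 Theorem] -/
theorem even_card_filter_of_typeRank_ne (hexp : ∀ g : G, g ^ 2 = 1) (h : IsCMTypeWith ρ (T : Set G))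
    (h8 : 8 ∣ Fintype.card G) (hne : typeRank G (T : Set G) ≠ Fintype.card G / 2 + 1)
    {χ : AddChar (Additive G) ℂ} (hχ : χ (Additive.ofMul ρ) = -1) :
    Even (T.filter fun s => χ (Additive.ofMul s) = -1).card := by
  by_contra hodd
  rw [Nat.not_even_iff_odd] at hodd
  exact hne (typeRank_eq_of_odd hexp h h8 hχ hodd)

end Odd

/-! ## §5 Even types: `16(rank − 1) ≤ |T|²`; order `8`: rank `2`; order `16`: rank `2` or `5` -/

section Even

omit [DecidableEq G] in
/-- The set of Kubota's surviving odd characters as a finset. [cite: Kubota1965, §4 Lemma 2] -/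
private theorem ncard_odd_nonvanishing_eq (T : Finset G) (ρ : G) :
    {χ : AddChar (Additive G) ℂ | χ (Additive.ofMul ρ) = -1 ∧ ∑ s ∈ T, χ (Additive.ofMul s) ≠ 0}.ncard =
      ((Finset.univ.filter fun χ : AddChar (Additive G) ℂ => χ (Additive.ofMul ρ) = -1).filter
        fun χ => ∑ s ∈ T, χ (Additive.ofMul s) ≠ 0).card := by
  rw [← Set.ncard_coe_finset]
  congr 1
  ext χ
  simp only [Set.mem_setOf_eq, Finset.coe_filter, Finset.mem_filter, Finset.mem_univ, true_and]

/-- **EVEN TYPES: every odd character sum is `≡ 0 (mod 4)`, so `16·(rank(T) − 1) ≤ |T|²`** (`8 ∣ |G|`, some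
`a_{χ₀}(T)` even): each surviving odd character has `(Σ_T χ)² ≥ 16` in Parseval's `Σ_{odd} (Σ_T χ)² = |T|²`.
[cite: Kubota1965, §4 Lemma 2] -/
theorem sixteen_mul_typeRank_sub_one_le (hexp : ∀ g : G, g ^ 2 = 1) (h : IsCMTypeWith ρ (T : Set G))
    (h8 : 8 ∣ Fintype.card G) {χ₀ : AddChar (Additive G) ℂ} (hχ₀ : χ₀ (Additive.ofMul ρ) = -1)
    (heven : Even (T.filter fun s => χ₀ (Additive.ofMul s) = -1).card) :
    16 * (typeRank G (T : Set G) - 1) ≤ T.card ^ 2 := by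
  have hrank := h.typeRank_eq_one_add_ncard_oddCharacters
  rw [ncard_odd_nonvanishing_eq] at hrank
  set O := Finset.univ.filter (fun χ : AddChar (Additive G) ℂ => χ (Additive.ofMul ρ) = -1) with hO
  set k : AddChar (Additive G) ℂ → ℤ := fun χ =>
    (T.card : ℤ) - 2 * ((T.filter fun s => χ (Additive.ofMul s) = -1).card : ℤ) with hk
  have hP : ∑ χ ∈ O, k χ ^ 2 = (T.card : ℤ) ^ 2 := sum_odd_sq_eq_int hexp h
  have hT := two_mul_card h
  -- `k χ = 0 ⟺ Σ_T χ = 0`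
  have hk0 : ∀ χ : AddChar (Additive G) ℂ, k χ = 0 ↔ ∑ s ∈ T, χ (Additive.ofMul s) = 0 := fun χ => by
    simp only [hk]
    rw [sum_char_eq_intCast hexp χ T]
    constructor
    · intro h0; exact_mod_cast h0
    · intro h0; exact_mod_cast h0
  -- every `k χ`, `χ` odd, is `≡ 0 (mod 4)`; the non-zero ones have square `≥ 16`
  have hk16 : ∀ χ ∈ O.filter (fun χ => ∑ s ∈ T, χ (Additive.ofMul s) ≠ 0), (16 : ℤ) ≤ k χ ^ 2 := by
    intro χ hχ
    rw [Finset.mem_filter] at hχ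
    have hχρ : χ (Additive.ofMul ρ) = -1 := (Finset.mem_filter.1 hχ.1).2
    have hpar := card_filter_mod_two_eq hexp h h8 hχ₀ hχρ
    have hkne : k χ ≠ 0 := fun hk0' => hχ.2 ((hk0 χ).1 hk0')
    obtain ⟨c, hc⟩ := h8
    obtain ⟨j, hj⟩ := heven
    have h4 : ∃ q : ℤ, k χ = 4 * q :=
      ⟨(c : ℤ) - (((T.filter fun s => χ (Additive.ofMul s) = -1).card / 2 : ℕ) : ℤ), by
        simp only [hk]; push_cast; omega⟩
    obtain ⟨q, hq⟩ := h4
    have hq0 : q ≠ 0 := fun hq0 => hkne (by rw [hq, hq0, mul_zero])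
    have : 1 ≤ q ^ 2 := by
      rcases Int.ne_iff_lt_or_gt.1 hq0 with hlt | hgt
      · nlinarith
      · nlinarith
    rw [hq]
    nlinarith
  have hsplit : ∑ χ ∈ O, k χ ^ 2 = ∑ χ ∈ O.filter (fun χ => ∑ s ∈ T, χ (Additive.ofMul s) ≠ 0), k χ ^ 2 := by
    rw [← Finset.sum_filter_add_sum_filter_not O (fun χ => ∑ s ∈ T, χ (Additive.ofMul s) ≠ 0)]
    rw [Finset.sum_eq_zero (s := O.filter fun χ => ¬ ∑ s ∈ T, χ (Additive.ofMul s) ≠ 0) fun χ hχ => ?_, add_zero]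
    have : k χ = 0 := (hk0 χ).2 (not_not.1 (Finset.mem_filter.1 hχ).2)
    rw [this]; norm_num
  have hle : (16 : ℤ) * ((O.filter fun χ => ∑ s ∈ T, χ (Additive.ofMul s) ≠ 0).card : ℤ) ≤ (T.card : ℤ) ^ 2 := by
    rw [← hP, hsplit]
    have := Finset.sum_le_sum hk16
    rw [Finset.sum_const, nsmul_eq_mul, mul_comm] at this
    exact this
  have hle' : 16 * (O.filter fun χ => ∑ s ∈ T, χ (Additive.ofMul s) ≠ 0).card ≤ T.card ^ 2 := by
    exact_mod_cast hle
  rw [hrank]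
  omega

/-- **ORDER `8` (`G ≅ (ℤ/2)³`): AN EVEN TYPE HAS RANK `2`** — `|T| = 4`, every odd sum is `0` or `±4`, and
`Σ_{odd} (Σ_T χ)² = 16` leaves exactly one surviving odd character.  (Dodson §3.3.2: a simple CM fourfold whose Galois
group is abelian of order `8` is nondegenerate — the degenerate types are the induced, imprimitive ones, §6.)
[cite: Kubota1965, §4 Lemma 2] [cite: Dodson1984, §3.3.2 Theorem] -/
theorem typeRank_eq_two_of_even (hexp : ∀ g : G, g ^ 2 = 1) (h : IsCMTypeWith ρ (T : Set G))
    (h8 : Fintype.card G = 8) {χ₀ : AddChar (Additive G) ℂ} (hχ₀ : χ₀ (Additive.ofMul ρ) = -1)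
    (heven : Even (T.filter fun s => χ₀ (Additive.ofMul s) = -1).card) :
    typeRank G (T : Set G) = 2 := by
  have hT : T.card = 4 := by have := two_mul_card h; omega
  have hle := sixteen_mul_typeRank_sub_one_le hexp h (by rw [h8]) hχ₀ heven
  rw [hT] at hle
  have h2 : 2 ≤ typeRank G (T : Set G) := by
    obtain ⟨χ, hχ, hne⟩ := exists_odd_sum_char_ne_zero hexp h
    rw [h.typeRank_eq_one_add_ncard_oddCharacters]
    have : 1 ≤ {χ : AddChar (Additive G) ℂ | χ (Additive.ofMul ρ) = -1 ∧
        ∑ s ∈ T, χ (Additive.ofMul s) ≠ 0}.ncard := by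
      rw [Nat.one_le_iff_ne_zero, Ne, Set.ncard_eq_zero (Set.toFinite _)]
      exact fun he => (Set.eq_empty_iff_forall_notMem.1 he χ) ⟨hχ, hne⟩
    omega
  omega

/-- **ORDER `16` (`G ≅ (ℤ/2)⁴`): AN EVEN TYPE HAS RANK `2` OR `5`** — `|T| = 8`, every odd sum is `0`, `±4` or
`±8`, and `Σ_{odd} (Σ_T χ)² = 64 = 64·n₆₄ + 16·n₁₆` leaves `1` or `4` surviving odd characters.
[cite: Kubota1965, §4 Lemma 2] -/
theorem typeRank_eq_two_or_five_of_even (hexp : ∀ g : G, g ^ 2 = 1) (h : IsCMTypeWith ρ (T : Set G))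
    (h16 : Fintype.card G = 16) {χ₀ : AddChar (Additive G) ℂ} (hχ₀ : χ₀ (Additive.ofMul ρ) = -1)
    (heven : Even (T.filter fun s => χ₀ (Additive.ofMul s) = -1).card) :
    typeRank G (T : Set G) = 2 ∨ typeRank G (T : Set G) = 5 := by
  have hT : T.card = 8 := by have := two_mul_card h; omega
  have hrank := h.typeRank_eq_one_add_ncard_oddCharacters
  rw [ncard_odd_nonvanishing_eq] at hrank
  set O := Finset.univ.filter (fun χ : AddChar (Additive G) ℂ => χ (Additive.ofMul ρ) = -1) with hO
  set k : AddChar (Additive G) ℂ → ℤ := fun χ =>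
    (T.card : ℤ) - 2 * ((T.filter fun s => χ (Additive.ofMul s) = -1).card : ℤ) with hk
  have hP : ∑ χ ∈ O, k χ ^ 2 = (T.card : ℤ) ^ 2 := sum_odd_sq_eq_int hexp h
  rw [hT] at hP
  -- `k χ = 0 ⟺ Σ_T χ = 0`
  have hk0 : ∀ χ : AddChar (Additive G) ℂ, k χ = 0 ↔ ∑ s ∈ T, χ (Additive.ofMul s) = 0 := fun χ => by
    simp only [hk]
    rw [sum_char_eq_intCast hexp χ T]
    constructor
    · intro h0; exact_mod_cast h0
    · intro h0; exact_mod_cast h0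
  -- the values of `k` on odd characters: `0`, `±4`, `±8`
  have hval : ∀ χ ∈ O, k χ = 0 ∨ k χ ^ 2 = 16 ∨ k χ ^ 2 = 64 := by
    intro χ hχ
    have hχρ : χ (Additive.ofMul ρ) = -1 := (Finset.mem_filter.1 hχ).2
    have hpar := card_filter_mod_two_eq hexp h (by rw [h16]; norm_num) hχ₀ hχρ
    have hle : (T.filter fun s => χ (Additive.ofMul s) = -1).card ≤ 8 := hT ▸ Finset.card_filter_le _ _
    obtain ⟨j, hj⟩ := heven
    obtain ⟨i, hi⟩ : ∃ i, (T.filter fun s => χ (Additive.ofMul s) = -1).card = 2 * i :=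
      ⟨(T.filter fun s => χ (Additive.ofMul s) = -1).card / 2, by omega⟩
    have hi4 : i ≤ 4 := by omega
    have hki : k χ = 8 - 4 * (i : ℤ) := by simp only [hk, hT, hi]; push_cast; ring
    interval_cases i
    · right; right; rw [hki]; norm_num
    · right; left; rw [hki]; norm_num
    · left; rw [hki]; norm_num
    · right; left; rw [hki]; norm_num
    · right; right; rw [hki]; norm_num
  -- split the Parseval sum: nonvanishing = (square 64) ⊔ (square 16)
  set P := O.filter (fun χ => ∑ s ∈ T, χ (Additive.ofMul s) ≠ 0) with hPdef
  set P64 := P.filter (fun χ => k χ ^ 2 = 64) with hP64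
  set P16 := P.filter (fun χ => ¬ k χ ^ 2 = 64) with hP16
  have hPsum : ∑ χ ∈ O, k χ ^ 2 = ∑ χ ∈ P, k χ ^ 2 := by
    rw [← Finset.sum_filter_add_sum_filter_not O (fun χ => ∑ s ∈ T, χ (Additive.ofMul s) ≠ 0)]
    rw [Finset.sum_eq_zero (s := O.filter fun χ => ¬ ∑ s ∈ T, χ (Additive.ofMul s) ≠ 0) fun χ hχ => ?_, add_zero]
    have : k χ = 0 := (hk0 χ).2 (not_not.1 (Finset.mem_filter.1 hχ).2)
    rw [this]; norm_num
  have h16val : ∀ χ ∈ P16, k χ ^ 2 = 16 := by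
    intro χ hχ
    rw [hP16, Finset.mem_filter, hPdef, Finset.mem_filter] at hχ
    rcases hval χ hχ.1.1 with h0 | h1 | h2
    · exact absurd ((hk0 χ).1 h0) hχ.1.2
    · exact h1
    · exact absurd h2 hχ.2
  have hsplit : ∑ χ ∈ P, k χ ^ 2 = 64 * (P64.card : ℤ) + 16 * (P16.card : ℤ) := by
    rw [← Finset.sum_filter_add_sum_filter_not P (fun χ => k χ ^ 2 = 64),
      Finset.sum_congr rfl fun χ hχ => (Finset.mem_filter.1 hχ).2, Finset.sum_congr rfl h16val,
      Finset.sum_const, Finset.sum_const, nsmul_eq_mul, nsmul_eq_mul]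
    ring
  have hcardP : P64.card + P16.card = P.card := Finset.card_filter_add_card_filter_not _
  rw [hPsum, hsplit] at hP
  have hPcard : P.card = 1 ∨ P.card = 4 := by omega
  rw [hrank]
  rcases hPcard with h1 | h4
  · left; rw [h1]
  · right; rw [h4]

/-- **On a group of exponent `2` and order `8` every CM type has rank `5` or `2`** (odd types: `5`; even types:
`2`; no type of rank `3` or `4`). [cite: Kubota1965, §4 Lemma 2] [cite: Dodson1984, §3.3.2 Theorem] -/
theorem typeRank_eq_five_or_two_of_card_eight (hexp : ∀ g : G, g ^ 2 = 1) (h : IsCMTypeWith ρ (T : Set G))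
    (h8 : Fintype.card G = 8) : typeRank G (T : Set G) = 5 ∨ typeRank G (T : Set G) = 2 := by
  obtain ⟨χ₀, hχ₀, -⟩ := exists_odd_sum_char_ne_zero hexp h
  rcases Nat.even_or_odd (T.filter fun s => χ₀ (Additive.ofMul s) = -1).card with hev | hodd
  · exact Or.inr (typeRank_eq_two_of_even hexp h h8 hχ₀ hev)
  · left
    rw [typeRank_eq_of_odd hexp h (by rw [h8]) hχ₀ hodd, h8]

/-- **On a group of exponent `2` and order `16` every CM type has rank `9`, `5` or `2`.** [cite: Kubota1965, §4 Lemma 2] -/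
theorem typeRank_mem_of_card_sixteen (hexp : ∀ g : G, g ^ 2 = 1) (h : IsCMTypeWith ρ (T : Set G))
    (h16 : Fintype.card G = 16) :
    typeRank G (T : Set G) = 9 ∨ typeRank G (T : Set G) = 5 ∨ typeRank G (T : Set G) = 2 := by
  obtain ⟨χ₀, hχ₀, -⟩ := exists_odd_sum_char_ne_zero hexp h
  rcases Nat.even_or_odd (T.filter fun s => χ₀ (Additive.ofMul s) = -1).card with hev | hodd
  · rcases typeRank_eq_two_or_five_of_even hexp h h16 hχ₀ hev with h2 | h5
    · exact Or.inr (Or.inr h2)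
    · exact Or.inr (Or.inl h5)
  · left
    rw [typeRank_eq_of_odd hexp h (by rw [h16]; norm_num) hχ₀ hodd, h16]

end Even

/-! ## §6 Rank `2` iff induced from an index-`2` subgroup -/

section RankTwo

/-- **An odd character CONSTANT on `T` is the only surviving one**: if `χ₀` is odd and constant on the CM type `T`,
then every other odd character `χ = ψχ₀` (`ψ` even, non-trivial) vanishes on `T`, so `rank(T) = 2`.
[cite: Kubota1965, §4 Lemma 2] [cite: Shimura1998, §8.4 Example (2)(A)] -/
theorem typeRank_eq_two_of_forall_eq (hexp : ∀ g : G, g ^ 2 = 1) (h : IsCMTypeWith ρ (T : Set G))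
    {χ₀ : AddChar (Additive G) ℂ} (hχ₀ : χ₀ (Additive.ofMul ρ) = -1)
    (hconst : ∀ s ∈ T, ∀ t ∈ T, χ₀ (Additive.ofMul s) = χ₀ (Additive.ofMul t)) :
    typeRank G (T : Set G) = 2 := by
  have hTpos : 0 < T.card := by
    have := two_mul_card h
    have : 0 < Fintype.card G := Fintype.card_pos
    omega
  obtain ⟨s₀, hs₀⟩ := Finset.card_pos.1 hTpos
  -- `Σ_T χ₀ = |T|·χ₀(s₀) ≠ 0`
  have hχ₀sum : ∑ s ∈ T, χ₀ (Additive.ofMul s) = T.card * χ₀ (Additive.ofMul s₀) := by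
    rw [Finset.sum_congr rfl fun s hs => hconst s hs s₀ hs₀, Finset.sum_const, nsmul_eq_mul]
  have hχ₀ne : ∑ s ∈ T, χ₀ (Additive.ofMul s) ≠ 0 := by
    rw [hχ₀sum]
    refine mul_ne_zero (by exact_mod_cast hTpos.ne') ?_
    rcases char_eq_one_or hexp χ₀ s₀ with h1 | h1 <;> rw [h1] <;> norm_num
  -- every other odd character vanishes
  have hother : ∀ χ : AddChar (Additive G) ℂ, χ (Additive.ofMul ρ) = -1 → χ ≠ χ₀ →
      ∑ s ∈ T, χ (Additive.ofMul s) = 0 := by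
    intro χ hχ hne
    have hψρ : (χ - χ₀) (Additive.ofMul ρ) = 1 := by
      rw [AddChar.sub_apply', hχ, hχ₀]; norm_num
    have hψ : χ - χ₀ ≠ 0 := fun h0 => hne (sub_eq_zero.1 h0)
    have h0 := sum_char_eq_zero_of_even h hψρ hψ
    have hfac : ∀ s ∈ T, χ (Additive.ofMul s) = (χ - χ₀) (Additive.ofMul s) * χ₀ (Additive.ofMul s₀) := by
      intro s hs
      rw [AddChar.sub_apply', ← hconst s hs s₀ hs₀, div_mul_cancel₀]
      rcases char_eq_one_or hexp χ₀ s with h1 | h1 <;> rw [h1] <;> norm_num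
    rw [Finset.sum_congr rfl hfac, ← Finset.sum_mul, h0, zero_mul]
  have hset : {χ : AddChar (Additive G) ℂ | χ (Additive.ofMul ρ) = -1 ∧ ∑ s ∈ T, χ (Additive.ofMul s) ≠ 0} = {χ₀} := by
    ext χ
    simp only [Set.mem_setOf_eq, Set.mem_singleton_iff]
    constructor
    · rintro ⟨hχ, hne⟩
      by_contra hχne
      exact hne (hother χ hχ hχne)
    · rintro rfl
      exact ⟨hχ₀, hχ₀ne⟩
  rw [h.typeRank_eq_one_add_ncard_oddCharacters, hset, Set.ncard_singleton]

/-- **RANK `2` ⟺ SOME ODD CHARACTER IS CONSTANT ON THE TYPE** (exponent `2`).  `⟸`: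
`typeRank_eq_two_of_forall_eq`; `⟹`: rank `2` leaves one surviving odd character `χ₀` (Kubota), and Parseval
`(Σ_T χ₀)² = |T|²` forces `χ₀ = ±1` identically on `T`. [cite: Kubota1965, §4 Lemma 2]
[cite: Shimura1998, §8.4 Example (2)(A)] -/
theorem typeRank_eq_two_iff (hexp : ∀ g : G, g ^ 2 = 1) (h : IsCMTypeWith ρ (T : Set G)) :
    typeRank G (T : Set G) = 2 ↔ ∃ χ : AddChar (Additive G) ℂ, χ (Additive.ofMul ρ) = -1 ∧
      ((∀ s ∈ T, χ (Additive.ofMul s) = 1) ∨ (∀ s ∈ T, χ (Additive.ofMul s) = -1)) := by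
  constructor
  · intro h2
    -- exactly one surviving odd character `χ₀`
    have hn : {χ : AddChar (Additive G) ℂ | χ (Additive.ofMul ρ) = -1 ∧
        ∑ s ∈ T, χ (Additive.ofMul s) ≠ 0}.ncard = 1 := by
      have := h.typeRank_eq_one_add_ncard_oddCharacters
      omega
    obtain ⟨χ₀, hχ₀⟩ := Set.ncard_eq_one.1 hn
    have hχ₀mem : χ₀ ∈ {χ : AddChar (Additive G) ℂ | χ (Additive.ofMul ρ) = -1 ∧
        ∑ s ∈ T, χ (Additive.ofMul s) ≠ 0} := by rw [hχ₀]; exact Set.mem_singleton χ₀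
    obtain ⟨hχ₀ρ, hχ₀ne⟩ := hχ₀mem
    refine ⟨χ₀, hχ₀ρ, ?_⟩
    -- Parseval: `(Σ_T χ₀)² = |T|²`, all other odd squares vanish
    set O := Finset.univ.filter (fun χ : AddChar (Additive G) ℂ => χ (Additive.ofMul ρ) = -1) with hO
    set k : AddChar (Additive G) ℂ → ℤ := fun χ =>
      (T.card : ℤ) - 2 * ((T.filter fun s => χ (Additive.ofMul s) = -1).card : ℤ) with hk
    have hP : ∑ χ ∈ O, k χ ^ 2 = (T.card : ℤ) ^ 2 := sum_odd_sq_eq_int hexp h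
    have hzero : ∀ χ ∈ O, χ ≠ χ₀ → k χ ^ 2 = 0 := by
      intro χ hχ hne
      have hχρ : χ (Additive.ofMul ρ) = -1 := (Finset.mem_filter.1 hχ).2
      have hvan : ∑ s ∈ T, χ (Additive.ofMul s) = 0 := by
        by_contra hv
        have : χ ∈ ({χ₀} : Set (AddChar (Additive G) ℂ)) := by rw [← hχ₀]; exact ⟨hχρ, hv⟩
        exact hne (Set.mem_singleton_iff.1 this)
      rw [sum_char_eq_intCast hexp χ T] at hvan
      have : k χ = 0 := by simp only [hk]; exact_mod_cast hvan
      rw [this]; norm_num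
    have hχ₀O : χ₀ ∈ O := by rw [hO, Finset.mem_filter]; exact ⟨Finset.mem_univ _, hχ₀ρ⟩
    have hk₀ : k χ₀ ^ 2 = (T.card : ℤ) ^ 2 := by
      rw [← hP, ← Finset.add_sum_erase O _ hχ₀O, Finset.sum_eq_zero fun χ hχ =>
        hzero χ (Finset.mem_of_mem_erase hχ) (Finset.ne_of_mem_erase hχ), add_zero]
    have hle : (T.filter fun s => χ₀ (Additive.ofMul s) = -1).card ≤ T.card := Finset.card_filter_le _ _
    have hcases : (T.filter fun s => χ₀ (Additive.ofMul s) = -1).card = 0 ∨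
        (T.filter fun s => χ₀ (Additive.ofMul s) = -1).card = T.card := by
      rcases sq_eq_sq_iff_eq_or_eq_neg.1 hk₀ with hp | hm
      · left
        simp only [hk] at hp
        omega
      · right
        simp only [hk] at hm
        omega
    rcases hcases with h0 | hfull
    · left
      intro s hs
      rcases char_eq_one_or hexp χ₀ s with h1 | h1
      · exact h1
      · exfalso
        have : s ∈ T.filter (fun s => χ₀ (Additive.ofMul s) = -1) := Finset.mem_filter.2 ⟨hs, h1⟩
        rw [Finset.card_eq_zero.1 h0] at this
        exact Finset.notMem_empty s this
    · right
      intro s hs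
      have hTeq : T.filter (fun s => χ₀ (Additive.ofMul s) = -1) = T :=
        Finset.eq_of_subset_of_card_le (Finset.filter_subset _ _) hfull.ge
      have : s ∈ T.filter (fun s => χ₀ (Additive.ofMul s) = -1) := by rw [hTeq]; exact hs
      exact (Finset.mem_filter.1 this).2
  · rintro ⟨χ₀, hχ₀, hconst⟩
    refine typeRank_eq_two_of_forall_eq hexp h hχ₀ fun s hs t ht => ?_
    rcases hconst with hc | hc
    · rw [hc s hs, hc t ht]
    · rw [hc s hs, hc t ht]

/-- **RANK `2` ⟺ THE TYPE IS A COSET OF AN INDEX-`2` SUBGROUP `H ∌ ρ`** (`T = H` or `T = G ∖ H = ρH`): on the CM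
field, iff the type is the set of ALL extensions of a CM type of an imaginary quadratic subfield (induced,
imprimitive; the abelian variety is isogenous to a power of a CM elliptic curve). [cite: Kubota1965, §4 Lemma 2]
[cite: Shimura1998, §8.4 Example (2)(A)] -/
theorem typeRank_eq_two_iff_exists_subgroup (hexp : ∀ g : G, g ^ 2 = 1) (h : IsCMTypeWith ρ (T : Set G)) :
    typeRank G (T : Set G) = 2 ↔ ∃ H : Subgroup G, ρ ∉ H ∧ H.index = 2 ∧
      ((T : Set G) = (H : Set G) ∨ (T : Set G) = (H : Set G)ᶜ) := by
  rw [typeRank_eq_two_iff hexp h]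
  constructor
  · rintro ⟨χ₀, hχ₀, hconst⟩
    -- the kernel of `χ₀`, an index-`2` subgroup missing `ρ`
    let H : Subgroup G := MonoidHom.ker
      { toFun := fun g => χ₀ (Additive.ofMul g)
        map_one' := by rw [ofMul_one, AddChar.map_zero_eq_one]
        map_mul' := fun a b => char_mul χ₀ a b }
    have hH : ∀ g : G, g ∈ H ↔ χ₀ (Additive.ofMul g) = 1 := fun g => by rw [MonoidHom.mem_ker]; rfl
    have hρH : ρ ∉ H := fun hρ => by
      have := (hH ρ).1 hρ
      rw [hχ₀] at this
      norm_num at this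
    have hχ₀0 : χ₀ ≠ 0 := fun h0 => by rw [h0, AddChar.zero_apply] at hχ₀; norm_num at hχ₀
    -- `|H| = |G|/2`
    have hHc : (H : Set G) = ↑(Finset.univ.filter fun g : G => ¬ χ₀ (Additive.ofMul g) = -1) := by
      ext g
      simp only [SetLike.mem_coe, hH, Finset.coe_filter, Finset.mem_univ, true_and, Set.mem_setOf_eq]
      constructor
      · intro h1; rw [h1]; norm_num
      · intro h1; exact (char_eq_one_or hexp χ₀ g).resolve_right h1
    have hcardH : 2 * (H : Set G).ncard = Fintype.card G := by
      rw [hHc, Set.ncard_coe_finset]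
      have h1 := two_mul_card_filter_univ_eq hexp hχ₀0
      have h2 := Finset.card_filter_add_card_filter_not (s := (Finset.univ : Finset G))
        (fun g : G => χ₀ (Additive.ofMul g) = -1)
      rw [Finset.card_univ] at h2
      omega
    have hidx : H.index = 2 := by
      have h1 := H.index_mul_card
      have h2 : Nat.card H = (H : Set G).ncard := Nat.card_coe_set_eq (H : Set G)
      rw [h2, Nat.card_eq_fintype_card, ← hcardH] at h1
      have hpos : 0 < (H : Set G).ncard := by
        rw [Set.ncard_pos (Set.toFinite _)]
        exact ⟨1, H.one_mem⟩
      exact Nat.eq_of_mul_eq_mul_right hpos h1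
    refine ⟨H, hρH, hidx, ?_⟩
    have hT := two_mul_card h
    rcases hconst with hc | hc
    · left
      refine Set.eq_of_subset_of_ncard_le (fun s hs => (hH s).2 (hc s (Finset.mem_coe.1 hs))) ?_ (Set.toFinite _)
      rw [Set.ncard_coe_finset]
      omega
    · right
      refine Set.eq_of_subset_of_ncard_le (fun s hs hsH => ?_) ?_ (Set.toFinite _)
      · have := (hH s).1 hsH
        rw [hc s (Finset.mem_coe.1 hs)] at this
        norm_num at this
      · have hcompl := Set.ncard_add_ncard_compl (H : Set G)
        rw [Nat.card_eq_fintype_card] at hcompl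
        rw [Set.ncard_coe_finset]
        omega
  · rintro ⟨H, hρH, hidx, hT⟩
    haveI : Fact (Nat.Prime 2) := ⟨Nat.prime_two⟩
    have hcyc : IsCyclic (G ⧸ H) := isCyclic_of_prime_card (p := 2) (by rw [← Subgroup.index_eq_card, hidx])
    obtain ⟨χ, hχρ, hker⟩ := AbelianKernels.exists_oddChar_ker hρH (rho_mul_rho h) hcyc
    refine ⟨χ, hχρ, ?_⟩
    rcases hT with hT | hT
    · left
      intro s hs
      have : s ∈ (H : Set G) := by rw [← hT]; exact Finset.mem_coe.2 hs
      exact (hker s).2 this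
    · right
      intro s hs
      have hsH : s ∉ H := by
        have : s ∈ (H : Set G)ᶜ := by rw [← hT]; exact Finset.mem_coe.2 hs
        exact this
      exact (char_eq_one_or hexp χ s).resolve_left fun h1 => hsH ((hker s).1 h1)

end RankTwo

end ExponentTwo

end CyclicCMType

end Literature.NumberTheory.ComplexMultiplication
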